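import Summits.HodgeConjecture.HodgeConjecture.Theorems.F0P3cStCharTSArtinMonoid         -- ★ p848426 «ARTIN-B» `eq_zero_of_sum_mul_char_eq_zero_on_subsemigroup`
import Summits.HodgeConjecture.HodgeConjecture.Theorems.F0P3CMBorelIwahoriDatum          -- ★ (T1) `exists_cmIwahoriDatum`, `placeForm_qsForm_eq`, `galAdicCompletionMap_involutive`
import Literature.NumberTheory.Automorphic.JacquetRayShellTrace                          -- ★ p848022 R2d «CASS-SHELL» `Representation.smoothTrace_indicator_shell_eq`
import Literature.NumberTheory.Automorphic.JacquetRayLevelDepth                          -- ★ p848448 «LEVEL-DEPTH» `exists_nhds_forall_range_fixedPointsMk_eq_top`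
import Literature.NumberTheory.Automorphic.JacquetRayExponents                           -- ★ `Representation.normalizedJacquet_apply`
import Literature.NumberTheory.Automorphic.UnitaryGroupRankOneTorusGeneration            -- ★ p848512 «TORUS-GEN» (model) `exists_scalar_mul_ray_mul_ray_inv`
import Literature.NumberTheory.Automorphic.UnitaryGroupRankOneCartanAnyInvolution        -- ★ `mem_torusU_of_coe_eq_diagonal`
import Literature.NumberTheory.Automorphic.CMLocalNonsplitBorelTransport                 -- ★ `localNonsplitEquiv_mem_torusU_iff`
import HarnessLib

/-!
# F0 · P3c · line LH6 «StCharTS» — the SHELL KIT of organ (S-i) `stub_StNoncuspidalMember` [Rogawski1990, Lemma 12.7.3 p. 195]: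
# two-point series, Artin-on-multisets, «TORUS-GEN» on `T(L⁺_v)`, dominance of `z·a`, the character on a deep shell, eigen-functional ⇒ `r_B(π) → ℂ_χ`

Cell `hodgecm-mathlib`, squad F0∕P3b → line LH6 (P3c), seat LH6-p02 (g0).  THEOREMS lane, sorry-free, `--supports stmt-HodgeConjecture-24833 --as helper`;
count-neutral.  The lemmas through which the B6 composition `F0P3cStCharTSNoncuspidalOfXIG.stNoncuspidalMember_of_XIG` (organ (S-i) of
`Cruxes/H413/Lines/F0_P3c_StCharTSPaydown.lean` ED. 1 :297, over the residual named input «XIG») runs: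
* §1 `tsum_intCast_mul_eq_sub_of_support_pair` (the two-point series of (β)); **`mem_of_forall_sum_sub_sum_eq`** («MULT-ARTIN»: if on a generating
  subsemigroup `Σ_{s₁} η − Σ_{s₂} η = θ` for multisets of characters, then `θ ∈ s₁` — ★ «ARTIN-B» on the distinct characters with multiplicities);
* §2 **`cm_torus_eq_central_mul_ray_mul_ray_inv`** («TORUS-GEN» on the CM carrier: every `t ∈ T(L⁺_v)` is `z·a₁·a₂⁻¹`, `z` central, `aᵢ` contracting rays
  `d(α, 1, (σ_w α)⁻¹)`, `0 < |α|_w < 1` — ★ model `exists_scalar_mul_ray_mul_ray_inv` pulled back along ★ `localNonsplitEquiv`);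
* §3 `dominant_central_mul` (dominance of `z·𝓘.a`, `z` central, in the binder shapes of ★ R2d ∕ (T1)); **`smoothTrace_shell_eq_mul_sum`** (admissible `ρ`,
  `tr π_N = Σ_s θ`: at every level inside the ★ «LEVEL-DEPTH» neighbourhood, `Tr ρ(𝟙_{K_n b K_n}) = ν(K_n)·#R·Σ_s θ(b)` — ★ R2d at `m = 1`);
  **`exists_intertwiningMap_twist_of_functional`** (a `θ`-eigen-functional of `π_N`, `θ = δ_P^{1/2}χ`, is a non-zero `T`-map `r_P(π) → ℂ_χ`).
HONEST LABEL: HC_CM is proved only modulo the 7 printed citations (2 remaining: hLiu418 = stmt-HodgeConjecture-24832, h413 = stmt-HodgeConjecture-24833)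
until rung 0 closes.

## References
* [Rogawski1990] J. D. Rogawski, *Automorphic Representations of Unitary Groups in Three Variables*, Ann. of Math. Stud. 123 (1990), §1.10 p. 9, §12.7
  Lemma 12.7.3 p. 195, p. 193.
* [Casselman1977] W. Casselman, *Characters and Jacquet modules*, Math. Ann. 230 (1977) 101–105, Thm. 5.2.
* [Casselman1995] W. Casselman, *Introduction to the theory of admissible representations of p-adic reductive groups* (1995 notes), Prop. 1.4.4, §4.1, §4.4.
* [BernsteinZelevinsky1977] I. N. Bernstein, A. V. Zelevinsky, *Induced representations of reductive p-adic groups I*, Ann. Sci. ÉNS 10 (1977), §2.3, Thm. 2.9.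
* [Lang2002] S. Lang, *Algebra*, 3rd ed., GTM 211 (2002), VI §4 Thm. 4.1.
* [PlatonovRapinchuk1994] V. Platonov, A. Rapinchuk, *Algebraic Groups and Number Theory* (1994), §5.1.
-/

set_option autoImplicit false
set_option linter.dupNamespace false

noncomputable section

open NumberField IsDedekindDomain MeasureTheory
open scoped Matrix MatrixGroups WithZero Topology Pointwise
open Literature.NumberTheory Literature.NumberTheory.Automorphic Literature.NumberTheory.Automorphic.UnitaryGroup
open Literature.NumberTheory.GaloisRepresentations
open Literature.NumberTheory.Rogawski1990

namespace Summit.HodgeConjecture.HodgeConjecture.Cruxes.H413.F0P3cStCharTSShellKit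

/-! ## §1 Generic algebra: the two-point series; from the shell identity of multisets to membership (Artin) -/

/-- A series over an integer weight supported on a pair `{p, m}` with `aX p = 1`, `aX m = -1` is the difference of the two terms.
[cite: Rogawski1990, §12.7 proof of Lemma 12.7.3 p. 195] -/
theorem tsum_intCast_mul_eq_sub_of_support_pair {X : Type*} (aX : X → ℤ) (t : X → ℂ) {p m : X} (hpm : p ≠ m)
    (hsupp : Function.support aX = {p, m}) (hp : aX p = 1) (hm : aX m = -1) :
    ∑' x, (aX x : ℂ) * t x = t p - t m := by
  classical
  have hzero : ∀ x ∉ ({p, m} : Finset X), (aX x : ℂ) * t x = 0 := by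
    intro x hx
    have hx' : x ∉ Function.support aX := by
      rw [hsupp]; simpa only [Finset.mem_insert, Finset.mem_singleton, Set.mem_insert_iff, Set.mem_singleton_iff] using hx
    rw [Function.notMem_support.1 hx', Int.cast_zero, zero_mul]
  rw [tsum_eq_sum hzero, Finset.sum_pair hpm, hp, hm]
  push_cast
  ring

/-- **From the shell identity of eigencharacter multisets to membership.**  If on a generating subsemigroup `B` of `T` the difference of the character sums
of two finite multisets `s₁, s₂` of characters equals a character `θ`, then `θ ∈ s₁` (Artin's independence of characters on `B`, ★ «ARTIN-B», applied to the
DISTINCT characters occurring, with coefficients the multiplicities). [cite: Rogawski1990, §12.7 proof of Lemma 12.7.3 p. 195] [cite: Lang2002, VI §4 Thm. 4.1] -/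
theorem mem_of_forall_sum_sub_sum_eq {T : Type*} [Group T] (B : Subsemigroup T) (hB : Subgroup.closure (B : Set T) = ⊤) (hne : ∃ b, b ∈ B)
    (s₁ s₂ : Multiset (T →* ℂˣ)) (θ : T →* ℂˣ)
    (h : ∀ b ∈ B, (s₁.map fun η : T →* ℂˣ => ((η b : ℂˣ) : ℂ)).sum - (s₂.map fun η : T →* ℂˣ => ((η b : ℂˣ) : ℂ)).sum = ((θ b : ℂˣ) : ℂ)) :
    θ ∈ s₁ := by
  classical
  -- the finite set of characters in play
  set S : Finset (T →* ℂˣ) := (s₁ + s₂ + {θ}).toFinset with hS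
  have hθS : θ ∈ S := by rw [hS, Multiset.mem_toFinset]; simp
  have hsub₁ : s₁.toFinset ⊆ S := by
    intro η hη; rw [Multiset.mem_toFinset] at hη; rw [hS, Multiset.mem_toFinset]; simp [hη]
  have hsub₂ : s₂.toFinset ⊆ S := by
    intro η hη; rw [Multiset.mem_toFinset] at hη; rw [hS, Multiset.mem_toFinset]; simp [hη]
  -- multiset character sums as sums over `S` weighted by multiplicities
  have hsum : ∀ s : Multiset (T →* ℂˣ), s.toFinset ⊆ S → ∀ b : T,
      (s.map fun η : T →* ℂˣ => ((η b : ℂˣ) : ℂ)).sum = ∑ η : ↥S, (s.count η.1 : ℂ) * ((η.1 b : ℂˣ) : ℂ) := by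
    intro s hs b
    have h1 : ∑ η ∈ s.toFinset, s.count η • ((η b : ℂˣ) : ℂ) = ∑ η ∈ S, s.count η • ((η b : ℂˣ) : ℂ) :=
      Finset.sum_subset hs fun η _ hη => by
        rw [Multiset.mem_toFinset, ← Multiset.count_eq_zero] at hη
        rw [hη, zero_smul]
    rw [Finset.sum_multiset_map_count, h1, ← Finset.sum_coe_sort S]
    simp only [nsmul_eq_mul]
  -- the coefficient vector `c = mult_{s₁} − mult_{s₂} − [· = θ]` vanishes on `B`
  let c : ↥S → ℂ := fun η => (s₁.count η.1 : ℂ) - (s₂.count η.1 : ℂ) - if η.1 = θ then 1 else 0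
  have hc : ∀ b ∈ B, ∑ η : ↥S, c η * ((η.1 b : ℂˣ) : ℂ) = 0 := by
    intro b hb
    have hθ : ((θ b : ℂˣ) : ℂ) = ∑ η : ↥S, (if η.1 = θ then (1 : ℂ) else 0) * ((η.1 b : ℂˣ) : ℂ) := by
      rw [Finset.sum_eq_single ⟨θ, hθS⟩]
      · simp
      · intro η _ hne
        have hne' : η.1 ≠ θ := fun h => hne (Subtype.ext h)
        rw [if_neg hne', zero_mul]
      · intro h; exact absurd (Finset.mem_univ _) h
    have hb' := h b hb
    rw [hsum s₁ hsub₁, hsum s₂ hsub₂, hθ, ← sub_eq_zero, ← Finset.sum_sub_distrib, ← Finset.sum_sub_distrib] at hb'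
    have key : ∑ η : ↥S, c η * ((η.1 b : ℂˣ) : ℂ) =
        ∑ η : ↥S, ((s₁.count η.1 : ℂ) * ((η.1 b : ℂˣ) : ℂ) - (s₂.count η.1 : ℂ) * ((η.1 b : ℂˣ) : ℂ) -
          (if η.1 = θ then (1 : ℂ) else 0) * ((η.1 b : ℂˣ) : ℂ)) :=
      Finset.sum_congr rfl fun η _ => by simp only [c]; ring
    rw [key]; exact hb'
  -- Artin: `c = 0`; read at `θ`
  have hc0 := F0P3cStCharTSArtinMonoid.eq_zero_of_sum_mul_char_eq_zero_on_subsemigroup B hB hne (fun η : ↥S => η.1)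
    Subtype.val_injective c hc
  have hθ0 := congr_fun hc0 ⟨θ, hθS⟩
  simp only [c, Pi.zero_apply, if_true] at hθ0
  have hnat : ((s₁.count θ : ℕ) : ℂ) = ((s₂.count θ + 1 : ℕ) : ℂ) := by push_cast; linear_combination hθ0
  rw [← Multiset.one_le_count_iff_mem, Nat.cast_injective hnat]
  exact Nat.le_add_left 1 _

/-! ## §2 «TORUS-GEN» on `T(L⁺_v) = (cmBorelTriple L 3 v).M`: every torus element is (central) · (contracting ray) · (contracting ray)⁻¹ -/

section TorusGen

variable (L : Type) [Field L] [NumberField L] [IsCMField L] (v : HeightOneSpectrum (𝓞 ↥(maximalRealSubfield L)))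
  (w : PlacesOver L v) (hw : IsCMField.complexConj L • w.1 = w.1)

set_option maxHeartbeats 800000 in  -- the one-place model vs the CM carrier: long defeq unfoldings of `cmLocalForm`∕`qsForm` (same class as ★ (T1))
/-- **«TORUS-GEN» (CM carrier).**  At a non-split `v` (`w ∣ v`, `c • w = w`), every `t ∈ T(L⁺_v) = (cmBorelTriple L 3 v).M` is `z · a₁ · a₂⁻¹` with `z` CENTRAL
(and in `T`) and `a₁, a₂ ∈ T` CONTRACTING RAYS: their one-place-model matrices (★ `localNonsplitEquiv`) are `d(αᵢ, 1, (σ_w αᵢ)⁻¹)` with `0 < |αᵢ|_w < 1` — exactly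
the rays the (T1) package ★ `exists_cmIwahoriDatum` accepts.  (★ model «TORUS-GEN» `exists_scalar_mul_ray_mul_ray_inv` pulled back along `e`; scalars are
central.)  Hence the subsemigroup `Z(G)·{rays}` GENERATES `T`. [cite: Rogawski1990, §1.10 p. 9] [cite: PlatonovRapinchuk1994, §5.1] -/
theorem cm_torus_eq_central_mul_ray_mul_ray_inv (t : ↥(cmBorelTriple L 3 v).M) :
    ∃ (z : ↥(unitaryGroupOfForm (conjLocal L (IsCMField.complexConj L) v) (cmLocalForm L 3 v)))
      (a₁ a₂ : ↥(torusU (conjLocal L (IsCMField.complexConj L) v) (cmLocalForm L 3 v))) (α₁ α₂ : w.1.adicCompletion L),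
      z ∈ Subgroup.center ↥(unitaryGroupOfForm (conjLocal L (IsCMField.complexConj L) v) (cmLocalForm L 3 v)) ∧
      z ∈ (cmBorelTriple L 3 v).M ∧
      α₁ ≠ 0 ∧ Valued.v α₁ < 1 ∧
      ((((localNonsplitEquiv (IsCMField.complexConj L) (Rogawski1990.qsForm L) (IsCMField.complexConj_ne_one L) w hw)
          (a₁ : ↥(unitaryGroupOfForm (conjLocal L (IsCMField.complexConj L) v) (cmLocalForm L 3 v))) :
        ↥(unitaryGroupOfForm (galAdicCompletionMap (L := L) (IsCMField.complexConj L) hw) (placeForm (Rogawski1990.qsForm L) w.1))) :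
          GL (Fin 3) (w.1.adicCompletion L)) : Matrix (Fin 3) (Fin 3) (w.1.adicCompletion L)) =
        Matrix.diagonal ![α₁, 1, ((galAdicCompletionMap (L := L) (IsCMField.complexConj L) hw) α₁)⁻¹] ∧
      α₂ ≠ 0 ∧ Valued.v α₂ < 1 ∧
      ((((localNonsplitEquiv (IsCMField.complexConj L) (Rogawski1990.qsForm L) (IsCMField.complexConj_ne_one L) w hw)
          (a₂ : ↥(unitaryGroupOfForm (conjLocal L (IsCMField.complexConj L) v) (cmLocalForm L 3 v))) :
        ↥(unitaryGroupOfForm (galAdicCompletionMap (L := L) (IsCMField.complexConj L) hw) (placeForm (Rogawski1990.qsForm L) w.1))) :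
          GL (Fin 3) (w.1.adicCompletion L)) : Matrix (Fin 3) (Fin 3) (w.1.adicCompletion L)) =
        Matrix.diagonal ![α₂, 1, ((galAdicCompletionMap (L := L) (IsCMField.complexConj L) hw) α₂)⁻¹] ∧
      (t : ↥(unitaryGroupOfForm (conjLocal L (IsCMField.complexConj L) v) (cmLocalForm L 3 v))) =
        z * (a₁ : ↥(unitaryGroupOfForm (conjLocal L (IsCMField.complexConj L) v) (cmLocalForm L 3 v))) *
          (a₂ : ↥(unitaryGroupOfForm (conjLocal L (IsCMField.complexConj L) v) (cmLocalForm L 3 v)))⁻¹ := by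
  -- the one-place model isomorphism, read on the CM carrier `U(Φ₃)(L⁺_v)` (defeq to `«local» L c 3 Φ₃ v`)
  set e : ↥(unitaryGroupOfForm (conjLocal L (IsCMField.complexConj L) v) (cmLocalForm L 3 v)) ≃ₜ*
      ↥(unitaryGroupOfForm (galAdicCompletionMap (L := L) (IsCMField.complexConj L) hw) (placeForm (Rogawski1990.qsForm L) w.1)) :=
    localNonsplitEquiv (IsCMField.complexConj L) (Rogawski1990.qsForm L) (IsCMField.complexConj_ne_one L) w hw with he
  have hJw := F0P3CMBorelIwahoriDatum.placeForm_qsForm_eq L v w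
  have hσσ : ∀ x, (galAdicCompletionMap (L := L) (IsCMField.complexConj L) hw) ((galAdicCompletionMap (L := L) (IsCMField.complexConj L) hw) x) = x :=
    fun x => F0P3CMBorelIwahoriDatum.galAdicCompletionMap_involutive L v w hw x
  -- a uniformiser of `L_w` (any element with `0 < |ϖ| < 1` would do)
  obtain ⟨ϖL, hϖL⟩ := w.1.valuation_exists_uniformizer L
  have hϖ : Valued.v ((ϖL : L) : w.1.adicCompletion L) = WithZero.exp (-1 : ℤ) := by
    rw [HeightOneSpectrum.valuedAdicCompletion_eq_valuation', hϖL]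
  have hϖ0 : ((ϖL : L) : w.1.adicCompletion L) ≠ 0 := by
    intro h
    rw [h, map_zero] at hϖ
    exact WithZero.exp_ne_zero hϖ.symm
  have hϖ1 : Valued.v ((ϖL : L) : w.1.adicCompletion L) < 1 := by
    rw [hϖ, ← WithZero.exp_zero]
    exact WithZero.exp_lt_exp.2 (by norm_num)
  -- `e t ∈ T′` and the model decomposition
  have ht' : e (t : ↥(unitaryGroupOfForm (conjLocal L (IsCMField.complexConj L) v) (cmLocalForm L 3 v))) ∈
      torusU (galAdicCompletionMap (L := L) (IsCMField.complexConj L) hw) (placeForm (Rogawski1990.qsForm L) w.1) :=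
    (localNonsplitEquiv_mem_torusU_iff L v w hw _).2 t.2
  obtain ⟨z', r₁, r₂, β, α₁, α₂, hz'T, hz', hα₁0, hα₁1, hr₁, hα₂0, hα₂1, hr₂, hdec⟩ :=
    exists_scalar_mul_ray_mul_ray_inv (galAdicCompletionMap (L := L) (IsCMField.complexConj L) hw) hJw hσσ hϖ0 hϖ1 ht'
  -- pull the three factors back along `e`
  have her₁ : e (e.symm r₁) ∈ torusU (galAdicCompletionMap (L := L) (IsCMField.complexConj L) hw) (placeForm (Rogawski1990.qsForm L) w.1) := by
    rw [ContinuousMulEquiv.apply_symm_apply]; exact mem_torusU_of_coe_eq_diagonal _ hJw hσσ hα₁0 r₁ hr₁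
  have her₂ : e (e.symm r₂) ∈ torusU (galAdicCompletionMap (L := L) (IsCMField.complexConj L) hw) (placeForm (Rogawski1990.qsForm L) w.1) := by
    rw [ContinuousMulEquiv.apply_symm_apply]; exact mem_torusU_of_coe_eq_diagonal _ hJw hσσ hα₂0 r₂ hr₂
  have hez : e (e.symm z') ∈ torusU (galAdicCompletionMap (L := L) (IsCMField.complexConj L) hw) (placeForm (Rogawski1990.qsForm L) w.1) := by
    rw [ContinuousMulEquiv.apply_symm_apply]; exact hz'T
  have hr₁T : e.symm r₁ ∈ (cmBorelTriple L 3 v).M := (localNonsplitEquiv_mem_torusU_iff L v w hw _).1 her₁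
  have hr₂T : e.symm r₂ ∈ (cmBorelTriple L 3 v).M := (localNonsplitEquiv_mem_torusU_iff L v w hw _).1 her₂
  have hzT : e.symm z' ∈ (cmBorelTriple L 3 v).M := (localNonsplitEquiv_mem_torusU_iff L v w hw _).1 hez
  -- scalars are central in the model, hence `e⁻¹ z'` is central
  have hz'c : ∀ g : ↥(unitaryGroupOfForm (galAdicCompletionMap (L := L) (IsCMField.complexConj L) hw) (placeForm (Rogawski1990.qsForm L) w.1)),
      g * z' = z' * g := by
    intro g
    have hsc : ((z' : GL (Fin 3) (w.1.adicCompletion L)) : Matrix (Fin 3) (Fin 3) (w.1.adicCompletion L)) =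
        β • (1 : Matrix (Fin 3) (Fin 3) (w.1.adicCompletion L)) := by
      rw [hz']
      ext i j
      fin_cases i <;> fin_cases j <;> simp
    apply Subtype.ext
    apply Units.ext
    change ((g : GL (Fin 3) (w.1.adicCompletion L)) : Matrix (Fin 3) (Fin 3) (w.1.adicCompletion L)) *
        ((z' : GL (Fin 3) (w.1.adicCompletion L)) : Matrix (Fin 3) (Fin 3) (w.1.adicCompletion L)) =
      ((z' : GL (Fin 3) (w.1.adicCompletion L)) : Matrix (Fin 3) (Fin 3) (w.1.adicCompletion L)) *
        ((g : GL (Fin 3) (w.1.adicCompletion L)) : Matrix (Fin 3) (Fin 3) (w.1.adicCompletion L))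
    rw [hsc, Matrix.mul_smul, Matrix.smul_mul, Matrix.mul_one, Matrix.one_mul]
  have hzc : e.symm z' ∈ Subgroup.center ↥(unitaryGroupOfForm (conjLocal L (IsCMField.complexConj L) v) (cmLocalForm L 3 v)) := by
    refine Subgroup.mem_center_iff.2 fun g => ?_
    apply e.injective
    rw [map_mul, map_mul, ContinuousMulEquiv.apply_symm_apply]
    exact hz'c (e g)
  refine ⟨e.symm z', ⟨e.symm r₁, hr₁T⟩, ⟨e.symm r₂, hr₂T⟩, α₁, α₂, hzc, hzT, hα₁0, hα₁1, ?_, hα₂0, hα₂1, ?_, ?_⟩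
  · show (((e (e.symm r₁) : ↥(unitaryGroupOfForm (galAdicCompletionMap (L := L) (IsCMField.complexConj L) hw) (placeForm (Rogawski1990.qsForm L) w.1))) :
        GL (Fin 3) (w.1.adicCompletion L)) : Matrix (Fin 3) (Fin 3) (w.1.adicCompletion L)) = _
    rw [ContinuousMulEquiv.apply_symm_apply]
    exact hr₁
  · show (((e (e.symm r₂) : ↥(unitaryGroupOfForm (galAdicCompletionMap (L := L) (IsCMField.complexConj L) hw) (placeForm (Rogawski1990.qsForm L) w.1))) :
        GL (Fin 3) (w.1.adicCompletion L)) : Matrix (Fin 3) (Fin 3) (w.1.adicCompletion L)) = _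
    rw [ContinuousMulEquiv.apply_symm_apply]
    exact hr₂
  · apply e.injective
    show e (t : ↥(unitaryGroupOfForm (conjLocal L (IsCMField.complexConj L) v) (cmLocalForm L 3 v))) = e (e.symm z' * e.symm r₁ * (e.symm r₂)⁻¹)
    rw [map_mul, map_mul, map_inv, ContinuousMulEquiv.apply_symm_apply, ContinuousMulEquiv.apply_symm_apply,
      ContinuousMulEquiv.apply_symm_apply]
    exact hdec

end TorusGen

/-! ## §3 Generic representation theory: dominance of `z·a` (`z` central); the character on a deep shell as a sum of eigencharacters;
from an eigen-functional of `π_N` to a `T`-map `r_P(π) → ℂ_χ` -/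

section Generic

variable {G : Type*} [Group G]

/-- Conjugation by `z·a` is conjugation by `a` for `z` central. [folklore] -/
theorem central_mul_conj_eq {z : G} (hz : z ∈ Subgroup.center G) (a x : G) : z * a * x * (z * a)⁻¹ = a * x * a⁻¹ := by
  have hc := Subgroup.mem_center_iff.1 hz
  calc z * a * x * (z * a)⁻¹ = z * (a * x * a⁻¹) * z⁻¹ := by group
    _ = a * x * a⁻¹ := by rw [← hc (a * x * a⁻¹), mul_inv_cancel_right]

/-- Inverse conjugation by `z·a` is inverse conjugation by `a` for `z` central. [folklore] -/
theorem central_mul_inv_conj_eq {z : G} (hz : z ∈ Subgroup.center G) (a x : G) : (z * a)⁻¹ * x * (z * a) = a⁻¹ * x * a := by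
  have hc := Subgroup.mem_center_iff.1 hz
  calc (z * a)⁻¹ * x * (z * a) = a⁻¹ * (z⁻¹ * x * z) * a := by group
    _ = a⁻¹ * x * a := by rw [mul_assoc z⁻¹, hc x, inv_mul_cancel_left]

/-- **Dominance of `b = z·a` at every Iwahori level from that of the ray `a`** (`z` central): the three binder shapes `haN`, `haNbar`, `hexh` of ★ R2d
`Representation.smoothTrace_indicator_shell_eq` ∕ the (T1) package ★ `exists_cmIwahoriDatum`. [cite: Casselman1995, Prop. 1.4.4, §4.1] -/
theorem dominant_central_mul (t : ParabolicTriple G) [TopologicalSpace G] (𝓘 : t.IwahoriDatum) {z : G} (hz : z ∈ Subgroup.center G)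
    (haN : ∀ n, ∀ x ∈ 𝓘.K n ⊓ t.N, 𝓘.a * x * 𝓘.a⁻¹ ∈ 𝓘.K n)
    (haNbar : ∀ n, ∀ x ∈ 𝓘.K n ⊓ 𝓘.Nbar, 𝓘.a⁻¹ * x * 𝓘.a ∈ 𝓘.K n ⊓ 𝓘.Nbar)
    (hexh : ∀ n, ∀ x ∈ t.N, ∃ m : ℕ, ∀ m', m ≤ m' → 𝓘.a ^ m' * x * (𝓘.a ^ m')⁻¹ ∈ 𝓘.K n) :
    (∀ n, ∀ x ∈ 𝓘.K n ⊓ t.N, z * 𝓘.a * x * (z * 𝓘.a)⁻¹ ∈ 𝓘.K n) ∧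
      (∀ n, ∀ x ∈ 𝓘.K n ⊓ 𝓘.Nbar, (z * 𝓘.a)⁻¹ * x * (z * 𝓘.a) ∈ 𝓘.K n ⊓ 𝓘.Nbar) ∧
      (∀ n, ∀ x ∈ t.N, ∃ m : ℕ, ∀ m', m ≤ m' → (z * 𝓘.a) ^ m' * x * ((z * 𝓘.a) ^ m')⁻¹ ∈ 𝓘.K n) := by
  refine ⟨fun n x hx => ?_, fun n x hx => ?_, fun n x hx => ?_⟩
  · rw [central_mul_conj_eq hz]; exact haN n x hx
  · rw [central_mul_inv_conj_eq hz]; exact haNbar n x hx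
  · obtain ⟨m, hm⟩ := hexh n x hx
    refine ⟨m, fun m' hm' => ?_⟩
    have hza : Commute z 𝓘.a := Subgroup.mem_center_iff.1 hz 𝓘.a |>.symm
    rw [hza.mul_pow, central_mul_conj_eq (Subgroup.pow_mem _ hz m')]
    exact hm m' hm'

variable [TopologicalSpace G] [IsTopologicalGroup G]

/-- **The character on a deep shell is `ν(K)·#R·Σ_s θ(b)`.**  For an admissible `ρ` with finite-dimensional Jacquet module whose `π_N`-trace is the sum
of the characters of a multiset `s` (★ «TMULT»), an Iwahori datum `𝓘`, and a torus element `b` dominant at every level (`hbN`, `hbNbar`, `hbexh`): at every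
level `K_n` inside the depth neighbourhood of ★ «LEVEL-DEPTH» (`[V^{K_n}] = V_N`), `Tr ρ(𝟙_{K_n b K_n}) = ν(K_n) · #R · Σ_{θ ∈ s} θ(b)` for any left transversal
`R` of `K_n ∕ (K_n ∩ ᵇK_n)` — ★ R2d `smoothTrace_indicator_shell_eq` at `m = 1`. [cite: Casselman1977, Thm. 5.2] [cite: Rogawski1990, §12.7 p. 193, p. 195] -/
theorem smoothTrace_shell_eq_mul_sum [MeasurableSpace G] [BorelSpace G] (μ : Measure G) [μ.IsMulLeftInvariant] [IsFiniteMeasureOnCompacts μ]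
    {V : Type*} [AddCommGroup V] [Module ℂ V] {ρ : Representation ℂ G V} (hadm : ρ.IsAdmissible)
    (t : ParabolicTriple G) (hN : IsClosed (t.N : Set G)) (𝓘 : t.IwahoriDatum) (hfd : FiniteDimensional ℂ (t.restrict ρ).Coinvariants)
    (s : Multiset (↥t.M →* ℂˣ)) (hs : ∀ m : ↥t.M, LinearMap.trace ℂ _ (ρ.jacquetModule t m) = (s.map fun θ : ↥t.M →* ℂˣ => ((θ m : ℂˣ) : ℂ)).sum)
    {b : G} (hbM : b ∈ t.M) (hbcomm : ∀ m ∈ t.M, m * b = b * m) (hbN : ∀ n, ∀ x ∈ 𝓘.K n ⊓ t.N, b * x * b⁻¹ ∈ 𝓘.K n)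
    (hbNbar : ∀ n, ∀ x ∈ 𝓘.K n ⊓ 𝓘.Nbar, b⁻¹ * x * b ∈ 𝓘.K n ⊓ 𝓘.Nbar)
    (hbexh : ∀ n, ∀ x ∈ t.N, ∃ m : ℕ, ∀ m', m ≤ m' → b ^ m' * x * (b ^ m')⁻¹ ∈ 𝓘.K n) :
    ∃ U ∈ 𝓝 (1 : G), ∀ n : ℕ, (𝓘.K n : Set G) ⊆ U → ∀ R : Finset G, IsLeftTransversal (𝓘.K n) (𝓘.K n ⊓ ConjAct.toConjAct b • 𝓘.K n) R →
      ρ.smoothTrace μ ((DoubleCoset.doubleCoset b (𝓘.K n : Set G) (𝓘.K n)).indicator fun _ => (1 : ℂ)) =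
        (μ.real (𝓘.K n : Set G) : ℂ) * (R.card : ℂ) * (s.map fun θ : ↥t.M →* ℂˣ => ((θ ⟨b, hbM⟩ : ℂˣ) : ℂ)).sum := by
  haveI := hfd
  obtain ⟨U, hU, hUr⟩ := Representation.exists_nhds_forall_range_fixedPointsMk_eq_top (ρ := ρ) t 𝓘 hadm
  refine ⟨U, hU, fun n hn R hR => ?_⟩
  have hrange := hUr n hn
  have hR1 : IsLeftTransversal (𝓘.K n) (𝓘.K n ⊓ ConjAct.toConjAct (b ^ 1) • 𝓘.K n) R := by rwa [pow_one]
  have key := Representation.smoothTrace_indicator_shell_eq μ hadm t (𝓘.isOpen_K n) (𝓘.isCompact_K n) hN (𝓘.factorization n)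
    hbM (fun m hm => hbcomm m (Subgroup.mem_inf.1 hm).2) (hbN n) (hbNbar n) (hbexh n) le_rfl hR1
  rw [pow_one, pow_one] at key
  rw [key, LinearMap.trace_restrict_eq_of_forall_mem _ _ (fun x => Submodule.eq_top_iff'.1 hrange _), hs ⟨b, hbM⟩]

/-- **From an eigen-functional of `π_N` to a non-zero `T`-map `r_P(π) → ℂ_χ`.**  A non-zero functional `ψ` on `V_N` with `ψ(π_N(m) w) = θ(m) ψ(w)` (★ «TMULT»),
where `θ = δ_P^{1/2} · χ` on `M`, is a non-zero intertwining map from the NORMALISED Jacquet module `r_P(π) = π_N ⊗ δ_P^{-1/2}` (★ `normalizedJacquet_apply`) to the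
character `χ` — the input of Frobenius reciprocity (★ «PI2-ID»). [cite: BernsteinZelevinsky1977, §2.3, Thm. 2.9] [cite: Casselman1995, §4.4 p. 45] -/
theorem exists_intertwiningMap_twist_of_functional {V : Type*} [AddCommGroup V] [Module ℂ V] {ρ : Representation ℂ G V}
    (t : ParabolicTriple G) [LocallyCompactSpace ↥t.P] (θ χ : ↥t.M →* ℂˣ)
    (hθχ : ∀ m : ↥t.M, θ m = rootDeltaChar t.P (Subgroup.inclusion t.M_le m) * χ m)
    (ψ : (t.restrict ρ).Coinvariants →ₗ[ℂ] ℂ) (hψ : ψ ≠ 0)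
    (heq : ∀ (m : ↥t.M) (w : (t.restrict ρ).Coinvariants), ψ (ρ.jacquetModule t m w) = ((θ m : ℂˣ) : ℂ) * ψ w) :
    ∃ Ψ : (ρ.normalizedJacquet t).IntertwiningMap ((Representation.trivial ℂ ↥t.M ℂ).twist χ), Ψ ≠ 0 := by
  refine ⟨⟨ψ, fun m => LinearMap.ext fun w => ?_⟩, fun h0 => hψ ?_⟩
  · -- both sides are `χ(m) · ψ(w)`
    rw [LinearMap.comp_apply, LinearMap.comp_apply, Representation.normalizedJacquet_apply, map_smul, heq, hθχ, smul_eq_mul,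
      Representation.twist_apply, Representation.trivial_apply, smul_eq_mul, Units.val_mul, mul_assoc, ← mul_assoc, Units.inv_mul, one_mul]
  · have := congrArg Representation.IntertwiningMap.toLinearMap h0
    exact this

end Generic

/-! ## §4 (ED. 2) Artin WITH MULTIPLICITIES; dimension zero ⇒ subsingleton (instance-explicit, for the CM Jacquet modules) -/

/-- **Artin with multiplicities.**  If on a generating subsemigroup `B` of `T` the difference of the character sums of two finite multisets `s₁, s₂`
of characters equals a character `θ`, then `s₁ = s₂ + {θ}` AS MULTISETS (★ «ARTIN-B» on the distinct characters occurring, coefficients =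
multiplicities; refines the kit's `mem_of_forall_sum_sub_sum_eq`). [cite: Rogawski1990, §12.7 proof of Lemma 12.7.3 p. 195] [cite: Lang2002, VI §4 Thm. 4.1] -/
theorem eq_add_singleton_of_forall_sum_sub_sum_eq {T : Type*} [Group T] (B : Subsemigroup T) (hB : Subgroup.closure (B : Set T) = ⊤)
    (hne : ∃ b, b ∈ B) (s₁ s₂ : Multiset (T →* ℂˣ)) (θ : T →* ℂˣ)
    (h : ∀ b ∈ B, (s₁.map fun η : T →* ℂˣ => ((η b : ℂˣ) : ℂ)).sum - (s₂.map fun η : T →* ℂˣ => ((η b : ℂˣ) : ℂ)).sum = ((θ b : ℂˣ) : ℂ)) :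
    s₁ = s₂ + {θ} := by
  classical
  -- the finite set of characters in play
  set S : Finset (T →* ℂˣ) := (s₁ + s₂ + {θ}).toFinset with hS
  have hθS : θ ∈ S := by rw [hS, Multiset.mem_toFinset]; simp
  have hsub₁ : s₁.toFinset ⊆ S := by
    intro η hη; rw [Multiset.mem_toFinset] at hη; rw [hS, Multiset.mem_toFinset]; simp [hη]
  have hsub₂ : s₂.toFinset ⊆ S := by
    intro η hη; rw [Multiset.mem_toFinset] at hη; rw [hS, Multiset.mem_toFinset]; simp [hη]
  -- multiset character sums as sums over `S` weighted by multiplicities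
  have hsum : ∀ s : Multiset (T →* ℂˣ), s.toFinset ⊆ S → ∀ b : T,
      (s.map fun η : T →* ℂˣ => ((η b : ℂˣ) : ℂ)).sum = ∑ η : ↥S, (s.count η.1 : ℂ) * ((η.1 b : ℂˣ) : ℂ) := by
    intro s hs b
    have h1 : ∑ η ∈ s.toFinset, s.count η • ((η b : ℂˣ) : ℂ) = ∑ η ∈ S, s.count η • ((η b : ℂˣ) : ℂ) :=
      Finset.sum_subset hs fun η _ hη => by
        rw [Multiset.mem_toFinset, ← Multiset.count_eq_zero] at hη
        rw [hη, zero_smul]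
    rw [Finset.sum_multiset_map_count, h1, ← Finset.sum_coe_sort S]
    simp only [nsmul_eq_mul]
  -- the coefficient vector `c = mult_{s₁} − mult_{s₂} − [· = θ]` vanishes on `B`
  let c : ↥S → ℂ := fun η => (s₁.count η.1 : ℂ) - (s₂.count η.1 : ℂ) - if η.1 = θ then 1 else 0
  have hc : ∀ b ∈ B, ∑ η : ↥S, c η * ((η.1 b : ℂˣ) : ℂ) = 0 := by
    intro b hb
    have hθ : ((θ b : ℂˣ) : ℂ) = ∑ η : ↥S, (if η.1 = θ then (1 : ℂ) else 0) * ((η.1 b : ℂˣ) : ℂ) := by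
      rw [Finset.sum_eq_single ⟨θ, hθS⟩]
      · simp
      · intro η _ hne
        have hne' : η.1 ≠ θ := fun h => hne (Subtype.ext h)
        rw [if_neg hne', zero_mul]
      · intro h; exact absurd (Finset.mem_univ _) h
    have hb' := h b hb
    rw [hsum s₁ hsub₁, hsum s₂ hsub₂, hθ, ← sub_eq_zero, ← Finset.sum_sub_distrib, ← Finset.sum_sub_distrib] at hb'
    have key : ∑ η : ↥S, c η * ((η.1 b : ℂˣ) : ℂ) =
        ∑ η : ↥S, ((s₁.count η.1 : ℂ) * ((η.1 b : ℂˣ) : ℂ) - (s₂.count η.1 : ℂ) * ((η.1 b : ℂˣ) : ℂ) -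
          (if η.1 = θ then (1 : ℂ) else 0) * ((η.1 b : ℂˣ) : ℂ)) :=
      Finset.sum_congr rfl fun η _ => by simp only [c]; ring
    rw [key]; exact hb'
  -- Artin: `c = 0`; read coefficient-wise
  have hc0 := F0P3cStCharTSArtinMonoid.eq_zero_of_sum_mul_char_eq_zero_on_subsemigroup B hB hne (fun η : ↥S => η.1)
    Subtype.val_injective c hc
  ext η
  rw [Multiset.count_add, Multiset.count_singleton]
  by_cases hηS : η ∈ S
  · have h0 := congr_fun hc0 ⟨η, hηS⟩
    simp only [c, Pi.zero_apply] at h0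
    have hnat : ((s₁.count η : ℕ) : ℂ) = ((s₂.count η + (if η = θ then 1 else 0) : ℕ) : ℂ) := by
      split_ifs at h0 ⊢ <;> push_cast <;> linear_combination h0
    exact Nat.cast_injective hnat
  · have h1 : η ∉ s₁ := fun h' => hηS (hsub₁ (Multiset.mem_toFinset.2 h'))
    have h2 : η ∉ s₂ := fun h' => hηS (hsub₂ (Multiset.mem_toFinset.2 h'))
    have h3 : η ≠ θ := fun h' => hηS (h' ▸ hθS)
    rw [Multiset.count_eq_zero.2 h1, Multiset.count_eq_zero.2 h2, if_neg h3]

/-- A finite-dimensional space of dimension `0` is a subsingleton (Mathlib, instance-explicit form for the CM Jacquet modules). [folklore] -/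
theorem subsingleton_of_finrank_eq_zero {W : Type*} [AddCommGroup W] [Module ℂ W] [FiniteDimensional ℂ W]
    (h : Module.finrank ℂ W = 0) : Subsingleton W :=
  (Module.finrank_zero_iff (R := ℂ)).1 h

end Summit.HodgeConjecture.HodgeConjecture.Cruxes.H413.F0P3cStCharTSShellKit

end
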